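import Mathlib
import HarnessLib
import Summits.NavierStokesRegularity.NavierStokesRegularity.Theorems.ThreadingFluxHorizonTowerZonalBridge
import Summits.NavierStokesRegularity.NavierStokesRegularity.Theorems.ThreadingFluxHorizonTowerZonalFrame

/-!
# Crux `PoloidalLiouville` (stmt-NavierStokesRegularity-1222, wall W1), crux idea «horizon-threading-tower» (ns-idea-15):
# DIPOLE TOWERS `{1, m, n}` AT ORDER ONE — helper 4: the factors of the two-term class identity are POLYNOMIAL, so `D·Q ≡ 0`
# splits as `D ≡ 0 ∨ Q ≡ 0`

ARM A (ns-exp-scalarLiouville g6), director KEY 2026-08-29T05:03:18Z, bottom-up helper for the third-shell step (S3)/(S3′) of «dipole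
towers decided at order one» (route ns-wall-eng-3 g3, TwoShellTowers-RESULTS §4b; plan `pub/ns-exp-scalarLiouville/HANDOFF.md` ADDENDUM 7;
critic remark r1 of ns-wall-crit-1 g4, 2026-08-29T05:01:51Z).  In (S3) the two-term parity class of the order-one identity reads, after
multiplication by `|a × x|²` and a positive radial weight, `D(x)·Q(x) = 0` off the centre, with `D(x) = ⟪a × x, ∇B(x)⟫` (the
rotational derivative of the shell `B`) or `D(x) = ⟪x, b × a⟫`, and `Q` built from `(‖x‖²)^k |a × x|²` and the MERIDIONAL MULTIPLIERS
`M_H(x) = ‖x‖²⟪∇H(x), a⟫ − ⟪a, x⟫⟪∇H(x), x⟫` of the shells.  The shells are polynomial functions (`Zonal.exists_mvPolynomial_of_homogeneous`),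
so all these factors are polynomial functions `Zonal.evalE d`; this file records that (closed under the linear combinations and radial
weights `(‖x‖²)^j` that occur) and proves the ★ PRODUCT DICHOTOMY `evalE_mul_dichotomy`: if `f`, `g` are polynomial functions on `ℝ³` with
`f·g = 0` off the origin then `f ≡ 0` or `g ≡ 0` (continuity across the origin + `MvPolynomial.funext` + the polynomial ring over `ℝ`
is an integral domain) — the critic's «zero set without interior» step (r1) with no topology of zero sets.

HONEST LABEL: helper lemmas toward a special case of a crux-idea conjecture; `HorizonTowerZonality`, `PoloidalLiouville` (1222) and NS
regularity are OPEN / NOT proved; nothing here is an NS statement.  `--supports stmt-NavierStokesRegularity-1222 --as helper`.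
-/

-- the summit and its single sub-problem share the name (CONVENTIONS §1)
set_option linter.dupNamespace false

noncomputable section

namespace Summit.NavierStokesRegularity.NavierStokesRegularity.Theorems.PoloidalLiouville.HorizonTower

open Set Function Filter Topology MvPolynomial
open scoped RealInnerProductSpace
open Literature.Analysis.FluidPDE (cross)
open Literature.Geometry.DiscreteGeometry (inner_fin3 norm_sq_fin3)

section DipoleTowerPolynomial

/-! ### The elementary polynomial functions of the argument -/

/-- A linear form `⟪a, ·⟫` is a polynomial function. [folklore] -/
theorem exists_evalE_inner_const (a : E3) :
    ∃ d : MvPolynomial (Fin 3) ℝ, ∀ x : E3, ⟪a, x⟫ = Zonal.evalE d x := by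
  refine ⟨C (a 0) * X 0 + C (a 1) * X 1 + C (a 2) * X 2, fun x => ?_⟩
  rw [inner_fin3]
  simp only [Zonal.evalE_add, Zonal.evalE_mul, Zonal.evalE_C, Zonal.evalE_X]

/-- The linear form `x ↦ ⟪x, b × a⟫ = det(x, b, a)` is a polynomial function. [folklore] -/
theorem exists_evalE_inner_cross_const (b a : E3) :
    ∃ d : MvPolynomial (Fin 3) ℝ, ∀ x : E3, ⟪x, cross b a⟫ = Zonal.evalE d x := by
  obtain ⟨d, hd⟩ := exists_evalE_inner_const (cross b a)
  exact ⟨d, fun x => by rw [real_inner_comm]; exact hd x⟩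

/-- `|a × x|² = ‖a‖²‖x‖² − ⟪a, x⟫²` is a polynomial function of `x`. [folklore] -/
theorem exists_evalE_crossNormSq (a : E3) :
    ∃ d : MvPolynomial (Fin 3) ℝ, ∀ x : E3, ‖cross a x‖ ^ 2 = Zonal.evalE d x := by
  refine ⟨C (‖a‖ ^ 2) * (X 0 ^ 2 + X 1 ^ 2 + X 2 ^ 2) - (C (a 0) * X 0 + C (a 1) * X 1 + C (a 2) * X 2) ^ 2,
    fun x => ?_⟩
  rw [Zonal.norm_cross_sq, norm_sq_fin3 x, inner_fin3]
  simp only [Zonal.evalE, map_add, map_sub, map_mul, map_pow, eval_C, eval_X]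

/-- The ROTATIONAL DERIVATIVE `⟪a × x, ∇P(x)⟫` of a polynomial function `P` about a fixed axis `a` is a polynomial function. [folklore] -/
theorem exists_evalE_rot (a : E3) (p : MvPolynomial (Fin 3) ℝ) :
    ∃ d : MvPolynomial (Fin 3) ℝ, ∀ x : E3, ⟪cross a x, gradient (Zonal.evalE p) x⟫ = Zonal.evalE d x := by
  refine ⟨(C (a 1) * X 2 - C (a 2) * X 1) * pderiv 0 p + (C (a 2) * X 0 - C (a 0) * X 2) * pderiv 1 p
      + (C (a 0) * X 1 - C (a 1) * X 0) * pderiv 2 p, fun x => ?_⟩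
  obtain ⟨c0, c1, c2⟩ := cross_fin3 a x
  rw [inner_fin3, c0, c1, c2, Zonal.gradient_evalE_apply, Zonal.gradient_evalE_apply, Zonal.gradient_evalE_apply]
  simp only [Zonal.evalE_add, Zonal.evalE_sub, Zonal.evalE_mul, Zonal.evalE_C, Zonal.evalE_X]

/-- The MERIDIONAL MULTIPLIER `‖x‖²⟪∇P(x), a⟫ − ⟪a, x⟫⟪∇P(x), x⟫` of a polynomial function `P` (its derivative along the meridional
tangent field `‖x‖² a − ⟪a,x⟫ x` of the axis `a`) is a polynomial function. [folklore] -/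
theorem exists_evalE_meridional (a : E3) (q : MvPolynomial (Fin 3) ℝ) :
    ∃ d : MvPolynomial (Fin 3) ℝ, ∀ x : E3,
      ‖x‖ ^ 2 * ⟪gradient (Zonal.evalE q) x, a⟫ - ⟪a, x⟫ * ⟪gradient (Zonal.evalE q) x, x⟫ = Zonal.evalE d x := by
  refine ⟨(X 0 ^ 2 + X 1 ^ 2 + X 2 ^ 2) * (pderiv 0 q * C (a 0) + pderiv 1 q * C (a 1) + pderiv 2 q * C (a 2))
      - (C (a 0) * X 0 + C (a 1) * X 1 + C (a 2) * X 2) * (pderiv 0 q * X 0 + pderiv 1 q * X 1 + pderiv 2 q * X 2),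
    fun x => ?_⟩
  rw [norm_sq_fin3, inner_fin3 (gradient _ x) a, inner_fin3 a x, inner_fin3 (gradient _ x) x, Zonal.gradient_evalE_apply,
    Zonal.gradient_evalE_apply, Zonal.gradient_evalE_apply]
  simp only [Zonal.evalE, map_add, map_sub, map_mul, map_pow, eval_C, eval_X]

/-! ### Closure under the operations of the argument -/

/-- Linear combinations of polynomial functions are polynomial functions. [folklore] -/
theorem exists_evalE_linComb {f g : E3 → ℝ} (hf : ∃ d : MvPolynomial (Fin 3) ℝ, ∀ x : E3, f x = Zonal.evalE d x)
    (hg : ∃ d : MvPolynomial (Fin 3) ℝ, ∀ x : E3, g x = Zonal.evalE d x) (c₁ c₂ : ℝ) :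
    ∃ d : MvPolynomial (Fin 3) ℝ, ∀ x : E3, c₁ * f x + c₂ * g x = Zonal.evalE d x := by
  obtain ⟨d₁, h₁⟩ := hf
  obtain ⟨d₂, h₂⟩ := hg
  exact ⟨C c₁ * d₁ + C c₂ * d₂, fun x => by
    rw [h₁, h₂]; simp only [Zonal.evalE_add, Zonal.evalE_mul, Zonal.evalE_C]⟩

/-- Products of polynomial functions are polynomial functions. [folklore] -/
theorem exists_evalE_mul {f g : E3 → ℝ} (hf : ∃ d : MvPolynomial (Fin 3) ℝ, ∀ x : E3, f x = Zonal.evalE d x)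
    (hg : ∃ d : MvPolynomial (Fin 3) ℝ, ∀ x : E3, g x = Zonal.evalE d x) :
    ∃ d : MvPolynomial (Fin 3) ℝ, ∀ x : E3, f x * g x = Zonal.evalE d x := by
  obtain ⟨d₁, h₁⟩ := hf
  obtain ⟨d₂, h₂⟩ := hg
  exact ⟨d₁ * d₂, fun x => by rw [h₁, h₂, Zonal.evalE_mul]⟩

/-- Radial weights `(‖x‖²)^j` times polynomial functions are polynomial functions. [folklore] -/
theorem exists_evalE_normSq_pow_mul {f : E3 → ℝ} (hf : ∃ d : MvPolynomial (Fin 3) ℝ, ∀ x : E3, f x = Zonal.evalE d x) (j : ℕ) :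
    ∃ d : MvPolynomial (Fin 3) ℝ, ∀ x : E3, (‖x‖ ^ 2) ^ j * f x = Zonal.evalE d x := by
  obtain ⟨d₁, h₁⟩ := hf
  refine ⟨(X 0 ^ 2 + X 1 ^ 2 + X 2 ^ 2) ^ j * d₁, fun x => ?_⟩
  rw [h₁, norm_sq_fin3]
  simp only [Zonal.evalE, map_add, map_mul, map_pow, eval_X]

/-- `(‖x‖²)^k |a × x|²` is a polynomial function. [folklore] -/
theorem exists_evalE_normSq_pow_mul_crossNormSq (a : E3) (k : ℕ) :
    ∃ d : MvPolynomial (Fin 3) ℝ, ∀ x : E3, (‖x‖ ^ 2) ^ k * ‖cross a x‖ ^ 2 = Zonal.evalE d x :=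
  exists_evalE_normSq_pow_mul (exists_evalE_crossNormSq a) k

/-! ### The product dichotomy -/

/-- A polynomial function vanishing off the origin vanishes identically (continuity across the origin). [folklore] -/
theorem evalE_eq_zero_of_eq_zero_off_origin {d : MvPolynomial (Fin 3) ℝ} (h : ∀ x : E3, x ≠ 0 → Zonal.evalE d x = 0) (x : E3) :
    Zonal.evalE d x = 0 := by
  have hcont : Continuous (Zonal.evalE d) := (Zonal.contDiff_evalE d).continuous
  have hclosed : IsClosed {y : E3 | Zonal.evalE d y = 0} := isClosed_eq hcont continuous_const
  have hdense : Dense ({0}ᶜ : Set E3) := dense_compl_singleton 0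
  have hsub : ({0}ᶜ : Set E3) ⊆ {y : E3 | Zonal.evalE d y = 0} := fun y hy => h y hy
  have huniv : {y : E3 | Zonal.evalE d y = 0} = univ := by
    have := (hdense.mono hsub).closure_eq
    rwa [hclosed.closure_eq] at this
  have hx : x ∈ {y : E3 | Zonal.evalE d y = 0} := by rw [huniv]; trivial
  exact hx

/-- ★ **PRODUCT DICHOTOMY for polynomial functions on `ℝ³`**: if `f` and `g` are polynomial functions with `f(x)·g(x) = 0` for all
`x ≠ 0`, then `f ≡ 0` or `g ≡ 0` (the polynomial ring `ℝ[X₀,X₁,X₂]` has no zero divisors and a polynomial is determined by its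
function). [folklore] -/
theorem evalE_mul_dichotomy {f g : E3 → ℝ} (hf : ∃ d : MvPolynomial (Fin 3) ℝ, ∀ x : E3, f x = Zonal.evalE d x)
    (hg : ∃ d : MvPolynomial (Fin 3) ℝ, ∀ x : E3, g x = Zonal.evalE d x) (h : ∀ x : E3, x ≠ 0 → f x * g x = 0) :
    (∀ x : E3, f x = 0) ∨ (∀ x : E3, g x = 0) := by
  classical
  obtain ⟨p, hp⟩ := hf
  obtain ⟨q, hq⟩ := hg
  have hzero : ∀ x : E3, Zonal.evalE (p * q) x = 0 :=
    evalE_eq_zero_of_eq_zero_off_origin fun x hx => by rw [Zonal.evalE_mul, ← hp, ← hq]; exact h x hx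
  have hpq : p * q = 0 := Zonal.eq_zero_of_evalE_eq_zero hzero
  rcases mul_eq_zero.1 hpq with h0 | h0
  · exact Or.inl fun x => by rw [hp, h0, Zonal.evalE_zero]
  · exact Or.inr fun x => by rw [hq, h0, Zonal.evalE_zero]

end DipoleTowerPolynomial

end Summit.NavierStokesRegularity.NavierStokesRegularity.Theorems.PoloidalLiouville.HorizonTower

end
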